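import Literature.AlgebraicGeometry.Frobenioids.FiberProducts
import HarnessLib

/-!
# Frobenioids I, Proposition 1.6 (Categorical Fiber Products) — part 2: (iii), (iv), and the
# formal clauses of (v), (vi) (STEP-0 calibration fragment of the abc-iut cell)

Mochizuki, *The geometry of Frobenioids I: the general theory*, Kyushu J. Math. **62** (2008)
293–400, §1, Proposition 1.6 "(Categorical Fiber Products)" and its proof, kurims text
pp. 27–28 [cite: MochizukiFrdI2008, Prop. 1.6]:

> "Let `Φ` be a divisorial monoid on a connected, totally epimorphic category `D`; `C → F_Φ` a
> Frobenioid. Let `D′` be a connected, totally epimorphic category; `D′ → D` a functor that maps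
> FSM-morphisms to FSM-morphisms. Denote by `Φ′ : D′ → Mon` the divisorial monoid obtained by
> restricting `Φ` to `D′`. Then: (i) There is a natural equivalence of categories
> `F_{Φ′} ⥲ F_Φ ×_D D′`. (ii) The categorical fiber product `C′ := C ×_D D′` equipped with the
> functor `C′ → F_{Φ′}` [obtained by applying "`(−) ×_D D′`" to the functor `C → F_Φ`] is a
> Frobenioid. (iii) A morphism of `C′` is a(n) isometry (respectively, morphism of a given
> Frobenius degree; co-angular morphism; LB-invertible morphism; pull-back morphism) if and only
> if its projection to `C` is. (iv) A base-isomorphism of `C′` is a morphism of Frobenius type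
> (respectively, pre-step; step) if and only if its projection to `C` is. Moreover, the projection
> functor `C′ → C` determines a bijection of monoids `O^▷(A′) ⥲ O^▷(A)`, for every `A′ ∈ Ob(C′)`
> that projects to `A ∈ Ob(C)`. (v) A object of `C′` is Frobenius-trivial (respectively, …;
> isotropic; Frobenius-isotropic) if and only if it projects to such an object of `C`. (vi) A
> object of `C′` is Aut-ample (respectively, Aut^sub-ample; End-ample) if it projects to such an
> object of `C`."

This file: the restricted monoid `Φ′`; (i) as an equivalence (`toFiberProduct`, full, faithful,

This file: all of (iii); all of (iv) (with the bijection of monoids `O^▷(A′) ⥲ O^▷(A)`); of (v)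
the clauses Frobenius-trivial, group-like, isotropic; of (vi) End-ample and Aut-ample.
The clauses "co-angular" and "pull-back morphism" of (iii), direction `C′ ⇒ C`, are NOT formal:
they lift the factorisation of Def. 1.3 (iv)(a) to `C′` and use Props. 1.4 (iv), 1.7 (iv)(v)
(co-angular) resp. two-out-of-three for pull-back morphisms.
NOT in this file: the 19 clauses of Def. 1.3 for `C′` (second half of (ii):
`FiberProductsFrobenioid*.lean`); (v) for quasi- and sub-quasi-Frobenius-trivial, metrically
trivial, base-trivial, perfect, unit-trivial, Frobenius-normalized, Frobenius-isotropic; (vi)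
Aut^sub-ample (see `FiberProductsObjects.lean`). Recorded for the referee: for "metrically trivial",
"base-trivial" (direction `C ⇒ C′`) and "Aut^sub-ample" the evident lifting argument needs an
isomorphism / a sub-automorphism of the `C`-component with PRESCRIBED projection to `D` (i.e.
Aut-ampleness-type input); we did not find it in the hypotheses as stated and leave these clauses
open rather than guess. No statement of the paper is strengthened.
-/

namespace Literature.AlgebraicGeometry.Frobenioids

open CategoryTheory Opposite

universe w v v' v'' u u' u''

namespace PreFrobenioid

variable {D : Type u} [Category.{v} D] {D' : Type u'} [Category.{v'} D']
  {Φ : Dᵒᵖ ⥤ CommMonCat.{w}} {C : Type u''} [Category.{v''} C]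
  {F : C ⥤ ElemFrobenioid Φ} {G : D' ⥤ D}

/-! ### Proposition 1.6 (iii) -/

/-- **Prop. 1.6 (iii)**, isometries. [cite: MochizukiFrdI2008, Prop. 1.6] -/
theorem isIsometry_fiberProduct_iff {X Y : FiberProduct F G} (f : X ⟶ Y) :
    IsIsometry (fiberProductFunctor F G) f ↔ IsIsometry F f.fst :=
  (ElemFrobenioid.pullEquiv Φ X.e.inv).map_eq_one_iff

/-- **Prop. 1.6 (iii)**, "morphism of a given Frobenius degree". [cite: MochizukiFrdI2008, Prop. 1.6] -/
theorem degFr_fiberProduct {X Y : FiberProduct F G} (f : X ⟶ Y) :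
    degFr (fiberProductFunctor F G) f = degFr F f.fst := rfl

/-- **Prop. 1.6 (iii)**, linear morphisms (special case of the preceding). [cite: MochizukiFrdI2008, Prop. 1.6] -/
theorem isLinear_fiberProduct_iff {X Y : FiberProduct F G} (f : X ⟶ Y) :
    IsLinear (fiberProductFunctor F G) f ↔ IsLinear F f.fst := Iff.rfl

/-- Base-isomorphisms of `C′` are the arrows whose `D′`-component is invertible. [cite: MochizukiFrdI2008, Prop. 1.6] -/
theorem isBaseIso_fiberProduct_iff {X Y : FiberProduct F G} (f : X ⟶ Y) :
    IsBaseIso (fiberProductFunctor F G) f ↔ IsIso f.snd := Iff.rfl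

/-- **Prop. 1.6 (iii)**, co-angular, direction `C ⇒ C′` (formal: project a factorisation).
[cite: MochizukiFrdI2008, Prop. 1.6] -/
theorem isCoAngular_fiberProduct_of_fst {X Y : FiberProduct F G} (f : X ⟶ Y)
    (h : IsCoAngular F f.fst) : IsCoAngular (fiberProductFunctor F G) f := by
  intro P Q γ β α hfac hα hβ₁ hβ₂ hor
  haveI : IsIso β.snd := hβ₂.2
  haveI : IsIso β.fst :=
    h γ.fst β.fst α.fst (by rw [← hfac]; rfl) hα ((isIsometry_fiberProduct_iff β).mp hβ₁)
      ⟨hβ₂.1, isBaseIso_fst_of_isIso_snd β⟩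
      (by
        rcases hor with hα' | hγ'
        · haveI : IsIso α.snd := hα'
          exact Or.inl (isBaseIso_fst_of_isIso_snd α)
        · haveI : IsIso γ.snd := hγ'
          exact Or.inr (isBaseIso_fst_of_isIso_snd γ))
  exact CFP.isIso_of_isIso_fst_snd β

/-- **Prop. 1.6 (iii)**, co-angular, direction `C′ ⇒ C` (not formal: lift the factorisation of
Def. 1.3 (iv)(a) for `f_C` to `C′` and use Props. 1.4 (iv), 1.7 (iv), (v)).
[cite: MochizukiFrdI2008, Prop. 1.6] -/
theorem isCoAngular_fst_of_fiberProduct (hF : IsFrobenioid F) {X Y : FiberProduct F G} (f : X ⟶ Y)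
    (h : IsCoAngular (fiberProductFunctor F G) f) : IsCoAngular F f.fst := by
  have hD : IsTotallyEpimorphic D := hF.isPreFrobenioid.isTotallyEpimorphic_base
  obtain ⟨P, Q, c, b, a, hfac, hc, hb, ha⟩ := hF.iv_a_exists f.fst
  obtain ⟨_, halin⟩ := hF.iv_b a ha
  refine (isCoAngular_iff_of_factorization F hF f.fst c b a hfac hc hb ha).mpr
    ((isCoAngular_iff_isMidAdjoint_of_isPreStep F hF b hb).mpr ?_)
  intro Q₁ Q₂ b₃ b₂ b₁ hbfac hb₂
  subst hbfac
  obtain ⟨hb₂₁, hb₃⟩ := isPreStep_factors F hD hb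
  obtain ⟨hb₁, _⟩ := isPreStep_factors F hD hb₂₁
  haveI : IsIso (Base F c) := hc.2
  haveI : IsIso (Base F b₃) := hb₃.2
  haveI : IsIso (Base F b₂) := hb₂.2.2
  haveI : IsIso (Base F b₁) := hb₁.2
  -- lift the factorisation `f_C = a ∘ b₁ ∘ b₂ ∘ b₃ ∘ c` to `C′`
  let X₁ := FiberProduct.liftTgt X c hc.2
  let X₂ := FiberProduct.liftTgt X₁ b₃ hb₃.2
  let X₃ := FiberProduct.liftTgt X₂ b₂ hb₂.2.2
  let X₄ := FiberProduct.liftTgt X₃ b₁ hb₁.2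
  have hw : Base F a ≫ Y.e.hom =
      (inv (Base F b₁) ≫ inv (Base F b₂) ≫ inv (Base F b₃) ≫ inv (Base F c) ≫ X.e.hom) ≫
        G.map f.snd := by
    simp only [Category.assoc]
    rw [← FiberProduct.hom_w f, ← hfac]
    simp only [base_comp, Category.assoc, IsIso.inv_hom_id_assoc]
  let at' : X₄ ⟶ Y := ⟨a, f.snd, hw⟩
  let c' : X ⟶ X₁ := FiberProduct.liftTgtHom X c hc.2
  let b₃' : X₁ ⟶ X₂ := FiberProduct.liftTgtHom X₁ b₃ hb₃.2
  let b₂' : X₂ ⟶ X₃ := FiberProduct.liftTgtHom X₂ b₂ hb₂.2.2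
  let b₁' : X₃ ⟶ X₄ := FiberProduct.liftTgtHom X₃ b₁ hb₁.2
  have hfacC' : (c' ≫ b₃') ≫ b₂' ≫ (b₁' ≫ at') = f := by
    refine CFP.hom_ext ?_ ?_
    · show (c ≫ b₃) ≫ b₂ ≫ b₁ ≫ a = f.fst
      rw [← hfac]
      simp only [Category.assoc]
    · show (𝟙 X.snd ≫ 𝟙 X.snd) ≫ 𝟙 X.snd ≫ 𝟙 X.snd ≫ f.snd = f.snd
      simp only [Category.id_comp]
  have hlin : IsLinear (fiberProductFunctor F G) (b₁' ≫ at') := IsLinear.comp F hb₁.1 halin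
  have hiso : IsIsometry (fiberProductFunctor F G) b₂' := (isIsometry_fiberProduct_iff b₂').mpr hb₂.1
  have hpre : IsPreStep (fiberProductFunctor F G) b₂' :=
    ⟨hb₂.2.1, show IsIso (𝟙 X.snd) from inferInstance⟩
  have hbi : IsBaseIso (fiberProductFunctor F G) (c' ≫ b₃') := by
    show IsIso (𝟙 X.snd ≫ 𝟙 X.snd)
    infer_instance
  haveI : IsIso b₂' := h (c' ≫ b₃') b₂' (b₁' ≫ at') hfacC' hlin hiso hpre (Or.inr hbi)
  exact CFP.isIso_fst b₂'

/-- **Prop. 1.6 (iii)**, co-angular morphisms. [cite: MochizukiFrdI2008, Prop. 1.6] -/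
theorem isCoAngular_fiberProduct_iff (hF : IsFrobenioid F) {X Y : FiberProduct F G} (f : X ⟶ Y) :
    IsCoAngular (fiberProductFunctor F G) f ↔ IsCoAngular F f.fst :=
  ⟨isCoAngular_fst_of_fiberProduct hF f, isCoAngular_fiberProduct_of_fst f⟩

/-- **Prop. 1.6 (iii)**, LB-invertible morphisms. [cite: MochizukiFrdI2008, Prop. 1.6] -/
theorem isLBInvertible_fiberProduct_iff (hF : IsFrobenioid F) {X Y : FiberProduct F G} (f : X ⟶ Y) :
    IsLBInvertible (fiberProductFunctor F G) f ↔ IsLBInvertible F f.fst :=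
  and_congr (isCoAngular_fiberProduct_iff hF f) (isIsometry_fiberProduct_iff f)

/-- **Prop. 1.6 (iii)**, pull-back morphisms, direction `C ⇒ C′`. [cite: MochizukiFrdI2008, Prop. 1.6] -/
theorem isPullbackMorphism_fiberProduct_of_fst {X Y : FiberProduct F G} (f : X ⟶ Y)
    (h : IsPullbackMorphism F f.fst) : IsPullbackMorphism (fiberProductFunctor F G) f := by
  intro W
  constructor
  · intro g₁ g₂ he
    have e₁ : g₁ ≫ f = g₂ ≫ f :=
      congrArg (fun p : PullbackHomData (fiberProductFunctor F G) f W => p.1.1) he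
    have e₂ : g₁.snd = g₂.snd :=
      congrArg (fun p : PullbackHomData (fiberProductFunctor F G) f W => p.1.2) he
    have e₁' : g₁.fst ≫ f.fst = g₂.fst ≫ f.fst := congrArg CFP.Hom.fst e₁
    have eb : Base F g₁.fst = Base F g₂.fst := by
      rw [← cancel_mono X.e.hom, FiberProduct.hom_w g₁, FiberProduct.hom_w g₂, e₂]
    exact CFP.hom_ext ((h W.fst).1 (Subtype.ext (Prod.ext e₁' eb))) e₂
  · rintro ⟨⟨δ, ε⟩, hδ⟩
    dsimp only at hδ
    let ε₀ : W.snd ⟶ X.snd := ε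
    have hδ' : δ.snd = ε₀ ≫ f.snd := hδ
    have cond : Base F δ.fst = (W.e.hom ≫ G.map ε₀ ≫ X.e.inv) ≫ Base F f.fst := by
      rw [← cancel_mono Y.e.hom]
      simp only [Category.assoc]
      rw [FiberProduct.hom_w f, Iso.inv_hom_id_assoc, FiberProduct.hom_w δ, hδ', G.map_comp]
    obtain ⟨g, hg⟩ := (h W.fst).2 ⟨(δ.fst, W.e.hom ≫ G.map ε₀ ≫ X.e.inv), cond⟩
    have hg₁ : g ≫ f.fst = δ.fst := congrArg (fun p : PullbackHomData F f.fst W.fst => p.1.1) hg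
    have hg₂ : Base F g = W.e.hom ≫ G.map ε₀ ≫ X.e.inv :=
      congrArg (fun p : PullbackHomData F f.fst W.fst => p.1.2) hg
    have hw : Base F g ≫ X.e.hom = W.e.hom ≫ G.map ε₀ := by
      rw [hg₂, Category.assoc, Category.assoc, Iso.inv_hom_id, Category.comp_id]
    exact ⟨⟨g, ε₀, hw⟩, Subtype.ext (Prod.ext (CFP.hom_ext hg₁ hδ'.symm) rfl)⟩

/-- **Prop. 1.6 (iii)**, pull-back morphisms, direction `C′ ⇒ C` (lift the factorisation of
Def. 1.3 (iv)(a); two-out-of-three for pull-back morphisms; Remark 1.2.1).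
[cite: MochizukiFrdI2008, Prop. 1.6] -/
theorem isPullbackMorphism_fst_of_fiberProduct (hF : IsFrobenioid F) {X Y : FiberProduct F G}
    (f : X ⟶ Y) (h : IsPullbackMorphism (fiberProductFunctor F G) f) : IsPullbackMorphism F f.fst := by
  obtain ⟨P, Q, c, b, a, hfac, hc, hb, ha⟩ := hF.iv_a_exists f.fst
  haveI : IsIso (Base F c) := hc.2
  haveI : IsIso (Base F b) := hb.2
  let X₁ := FiberProduct.liftTgt X c hc.2
  let X₂ := FiberProduct.liftTgt X₁ b hb.2
  have hw : Base F a ≫ Y.e.hom = (inv (Base F b) ≫ inv (Base F c) ≫ X.e.hom) ≫ G.map f.snd := by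
    simp only [Category.assoc]
    rw [← FiberProduct.hom_w f, ← hfac]
    simp only [base_comp, Category.assoc, IsIso.inv_hom_id_assoc]
  let at' : X₂ ⟶ Y := ⟨a, f.snd, hw⟩
  let c' : X ⟶ X₁ := FiberProduct.liftTgtHom X c hc.2
  let b' : X₁ ⟶ X₂ := FiberProduct.liftTgtHom X₁ b hb.2
  have hfacC' : (c' ≫ b') ≫ at' = f := by
    refine CFP.hom_ext ?_ ?_
    · show (c ≫ b) ≫ a = f.fst
      rw [← hfac, Category.assoc]
    · show (𝟙 X.snd ≫ 𝟙 X.snd) ≫ f.snd = f.snd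
      simp only [Category.id_comp]
  have hat : IsPullbackMorphism (fiberProductFunctor F G) at' :=
    isPullbackMorphism_fiberProduct_of_fst at' ha
  have hcb : IsPullbackMorphism (fiberProductFunctor F G) (c' ≫ b') :=
    IsPullbackMorphism.of_comp (fiberProductFunctor F G) hat (by rw [hfacC']; exact h)
  have hbi : IsBaseIso (fiberProductFunctor F G) (c' ≫ b') := by
    show IsIso (𝟙 X.snd ≫ 𝟙 X.snd)
    infer_instance
  haveI : IsIso (c' ≫ b') :=
    (isPullbackMorphism_and_isBaseIso_iff_isIso (fiberProductFunctor F G) _).mp ⟨hcb, hbi⟩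
  haveI : IsIso (c ≫ b) := CFP.isIso_fst (c' ≫ b')
  rw [← hfac, ← Category.assoc]
  exact IsPullbackMorphism.comp F (isPullbackMorphism_of_isIso F (c ≫ b)) ha

/-- **Prop. 1.6 (iii)**, pull-back morphisms. [cite: MochizukiFrdI2008, Prop. 1.6] -/
theorem isPullbackMorphism_fiberProduct_iff (hF : IsFrobenioid F) {X Y : FiberProduct F G} (f : X ⟶ Y) :
    IsPullbackMorphism (fiberProductFunctor F G) f ↔ IsPullbackMorphism F f.fst :=
  ⟨isPullbackMorphism_fst_of_fiberProduct hF f, isPullbackMorphism_fiberProduct_of_fst f⟩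

/-! ### Proposition 1.6 (iv) -/

/-- **Prop. 1.6 (iv)**, pre-steps: a base-isomorphism of `C′` is a pre-step iff its projection is.
[cite: MochizukiFrdI2008, Prop. 1.6] -/
theorem isPreStep_fiberProduct_iff {X Y : FiberProduct F G} (f : X ⟶ Y)
    (hf : IsBaseIso (fiberProductFunctor F G) f) :
    IsPreStep (fiberProductFunctor F G) f ↔ IsPreStep F f.fst := by
  haveI : IsIso f.snd := hf
  exact ⟨fun h => ⟨h.1, isBaseIso_fst_of_isIso_snd f⟩, fun h => ⟨h.1, hf⟩⟩

/-- **Prop. 1.6 (iv)**, Frobenius type: a base-isomorphism of `C′` is of Frobenius type iff its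
projection is. [cite: MochizukiFrdI2008, Prop. 1.6] -/
theorem isFrobeniusType_fiberProduct_iff (hF : IsFrobenioid F) {X Y : FiberProduct F G} (f : X ⟶ Y)
    (hf : IsBaseIso (fiberProductFunctor F G) f) :
    IsFrobeniusType (fiberProductFunctor F G) f ↔ IsFrobeniusType F f.fst := by
  haveI : IsIso f.snd := hf
  exact ⟨fun h => ⟨(isLBInvertible_fiberProduct_iff hF f).mp h.1, isBaseIso_fst_of_isIso_snd f⟩,
    fun h => ⟨(isLBInvertible_fiberProduct_iff hF f).mpr h.1, hf⟩⟩

/-- A base-isomorphism of `C′` is an isomorphism iff its projection to `C` is. [cite: MochizukiFrdI2008, Prop. 1.6] -/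
theorem isIso_fiberProduct_iff {X Y : FiberProduct F G} (f : X ⟶ Y)
    (hf : IsBaseIso (fiberProductFunctor F G) f) : IsIso f ↔ IsIso f.fst := by
  haveI : IsIso f.snd := hf
  exact ⟨fun _ => CFP.isIso_fst f, fun _ => CFP.isIso_of_isIso_fst_snd f⟩

/-- **Prop. 1.6 (iv)**, steps: a base-isomorphism of `C′` is a step iff its projection is.
[cite: MochizukiFrdI2008, Prop. 1.6] -/
theorem isStep_fiberProduct_iff {X Y : FiberProduct F G} (f : X ⟶ Y)
    (hf : IsBaseIso (fiberProductFunctor F G) f) :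
    IsStep (fiberProductFunctor F G) f ↔ IsStep F f.fst :=
  and_congr (isPreStep_fiberProduct_iff f hf) (not_congr (isIso_fiberProduct_iff f hf))

/-- A base-identity endomorphism `(e, id)` of `(A, A′, α)` has base-identity `C`-component `e`.
[cite: MochizukiFrdI2008, Prop. 1.6] -/
theorem isBaseIdentity_fst_of_isBaseIdentity {X : FiberProduct F G} {e : X ⟶ X}
    (he : IsBaseIdentity (fiberProductFunctor F G) e) : IsBaseIdentity F e.fst := by
  have hb : e.snd = 𝟙 X.snd := he
  have hw : Base F e.fst ≫ X.e.hom = X.e.hom ≫ G.map e.snd := FiberProduct.hom_w e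
  rw [hb, G.map_id, Category.comp_id] at hw
  show Base F e.fst = 𝟙 _
  rw [← cancel_mono X.e.hom, hw, Category.id_comp]

/-- **Prop. 1.6 (iv), "Moreover"**: the projection `C′ → C` induces `O^▷(A′) ⥲ O^▷(A)`.
[cite: MochizukiFrdI2008, Prop. 1.6] -/
def endSubmonoidEquiv (X : FiberProduct F G) :
    endSubmonoid (fiberProductFunctor F G) X ≃* endSubmonoid F X.fst where
  toFun e := ⟨CFP.Hom.fst e.1, show _ ∧ _ from ⟨isBaseIdentity_fst_of_isBaseIdentity e.2.1, e.2.2⟩⟩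
  invFun u := ⟨⟨(show X.fst ⟶ X.fst from u.1), 𝟙 X.snd, by
      have hu : Base F (show X.fst ⟶ X.fst from u.1) = 𝟙 _ := u.2.1
      show Base F (show X.fst ⟶ X.fst from u.1) ≫ X.e.hom = X.e.hom ≫ G.map (𝟙 X.snd)
      rw [hu, G.map_id, Category.id_comp, Category.comp_id]⟩,
    show _ ∧ _ from ⟨rfl, u.2.2⟩⟩
  left_inv e := by
    have hb : CFP.Hom.snd e.1 = 𝟙 X.snd := e.2.1
    exact Subtype.ext (CFP.hom_ext rfl hb.symm)
  right_inv _ := rfl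
  map_mul' _ _ := rfl

/-! ### Proposition 1.6 (v), (vi): some of the object clauses -/

/-- **Prop. 1.6 (v)**, group-like: `(A, A′, α)` is group-like iff `A` is (`Φ′(A′) = Φ(D′→D A′) ≅ Φ(A_D)`).
[cite: MochizukiFrdI2008, Prop. 1.6] -/
theorem isGroupLikeObj_fiberProduct_iff (X : FiberProduct F G) :
    IsGroupLikeObj (fiberProductFunctor F G) X ↔ IsGroupLikeObj F X.fst := by
  constructor
  · intro h x
    have hx : pull Φ X.e.inv x = 1 := h (pull Φ X.e.inv x)
    exact (ElemFrobenioid.pullEquiv Φ X.e.inv).map_eq_one_iff.mp hx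
  · intro h x
    have hx : pull Φ X.e.hom x = 1 := h (pull Φ X.e.hom x)
    exact (ElemFrobenioid.pullEquiv Φ X.e.hom).map_eq_one_iff.mp hx

/-- **Prop. 1.6 (v)**, isotropic, direction `C ⇒ C′`. [cite: MochizukiFrdI2008, Prop. 1.6] -/
theorem isIsotropic_fiberProduct_of_fst (X : FiberProduct F G) (h : IsIsotropic F X.fst) :
    IsIsotropic (fiberProductFunctor F G) X := by
  intro Y f hf₁ hf₂
  haveI : IsIso f.snd := hf₂.2
  haveI : IsIso f.fst :=
    h f.fst ((isIsometry_fiberProduct_iff f).mp hf₁) ((isPreStep_fiberProduct_iff f hf₂.2).mp hf₂)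
  exact CFP.isIso_of_isIso_fst_snd f

/-- **Prop. 1.6 (v)**, isotropic, direction `C′ ⇒ C` (lift an isometric pre-step as `(g, id)`).
[cite: MochizukiFrdI2008, Prop. 1.6] -/
theorem isIsotropic_fst_of_fiberProduct (X : FiberProduct F G)
    (h : IsIsotropic (fiberProductFunctor F G) X) : IsIsotropic F X.fst := by
  intro B g hg₁ hg₂
  let g' : X ⟶ FiberProduct.liftTgt X g hg₂.2 := FiberProduct.liftTgtHom X g hg₂.2
  haveI : IsIso g' :=
    h g' ((isIsometry_fiberProduct_iff g').mpr hg₁) ⟨hg₂.1, show IsIso (𝟙 X.snd) from inferInstance⟩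
  exact CFP.isIso_fst g'

/-- **Prop. 1.6 (v)**, isotropic objects. [cite: MochizukiFrdI2008, Prop. 1.6] -/
theorem isIsotropic_fiberProduct_iff (X : FiberProduct F G) :
    IsIsotropic (fiberProductFunctor F G) X ↔ IsIsotropic F X.fst :=
  ⟨isIsotropic_fst_of_fiberProduct X, isIsotropic_fiberProduct_of_fst X⟩

/-- **Prop. 1.6 (v)**, Frobenius-trivial, direction `C ⇒ C′`: lift `ζ_A` as `(ζ_A(n), id)`.
[cite: MochizukiFrdI2008, Prop. 1.6] -/
theorem isFrobeniusTrivial_fiberProduct_of_fst (hF : IsFrobenioid F) (X : FiberProduct F G)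
    (h : IsFrobeniusTrivial F X.fst) : IsFrobeniusTrivial (fiberProductFunctor F G) X := by
  obtain ⟨ζ, hζ⟩ := h
  have hw : ∀ n : ℕ+, Base F (show X.fst ⟶ X.fst from ζ n) ≫ X.e.hom = X.e.hom ≫ G.map (𝟙 X.snd) :=
    fun n => by rw [show Base F (show X.fst ⟶ X.fst from ζ n) = 𝟙 _ from (hζ n).2.1, G.map_id,
      Category.id_comp, Category.comp_id]
  let ζ' : ℕ+ →* End X :=
    { toFun := fun n => ⟨(show X.fst ⟶ X.fst from ζ n), 𝟙 X.snd, hw n⟩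
      map_one' := CFP.hom_ext (ζ.map_one) rfl
      map_mul' := fun m n => CFP.hom_ext (ζ.map_mul m n) (Category.id_comp _).symm }
  refine ⟨ζ', fun n => ⟨(hζ n).1, rfl, ?_⟩⟩
  exact (isFrobeniusType_fiberProduct_iff hF (ζ' n) (show IsIso (𝟙 X.snd) from inferInstance)).mpr
    (hζ n).2.2

/-- **Prop. 1.6 (v)**, Frobenius-trivial, direction `C′ ⇒ C`: project `ζ`.
[cite: MochizukiFrdI2008, Prop. 1.6] -/
theorem isFrobeniusTrivial_fst_of_fiberProduct (hF : IsFrobenioid F) (X : FiberProduct F G)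
    (h : IsFrobeniusTrivial (fiberProductFunctor F G) X) : IsFrobeniusTrivial F X.fst := by
  obtain ⟨ζ, hζ⟩ := h
  let π : End X →* End X.fst :=
    { toFun := fun e => CFP.Hom.fst e
      map_one' := rfl
      map_mul' := fun _ _ => rfl }
  exact ⟨π.comp ζ, fun n => ⟨(hζ n).1, isBaseIdentity_fst_of_isBaseIdentity (hζ n).2.1,
    (isFrobeniusType_fiberProduct_iff hF _ (hζ n).2.2.2).mp (hζ n).2.2⟩⟩

/-- **Prop. 1.6 (v)**, Frobenius-trivial objects. [cite: MochizukiFrdI2008, Prop. 1.6] -/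
theorem isFrobeniusTrivial_fiberProduct_iff (hF : IsFrobenioid F) (X : FiberProduct F G) :
    IsFrobeniusTrivial (fiberProductFunctor F G) X ↔ IsFrobeniusTrivial F X.fst :=
  ⟨isFrobeniusTrivial_fst_of_fiberProduct hF X, isFrobeniusTrivial_fiberProduct_of_fst hF X⟩

/-- **Prop. 1.6 (vi)**, End-ample: if `A` is End-ample then so is `(A, A′, α)`.
[cite: MochizukiFrdI2008, Prop. 1.6] -/
theorem isEndAmple_fiberProduct_of_fst (X : FiberProduct F G) (h : IsEndAmple F X.fst) :
    IsEndAmple (fiberProductFunctor F G) X := by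
  intro e'
  let e₀ : X.snd ⟶ X.snd := e'
  obtain ⟨e, he⟩ := h (X.e.hom ≫ G.map e₀ ≫ X.e.inv)
  have hw : Base F e ≫ X.e.hom = X.e.hom ≫ G.map e₀ := by
    rw [he, Category.assoc, Category.assoc, Iso.inv_hom_id, Category.comp_id]
  exact ⟨⟨e, e₀, hw⟩, rfl⟩

/-- **Prop. 1.6 (vi)**, Aut-ample: if `A` is Aut-ample then so is `(A, A′, α)`.
[cite: MochizukiFrdI2008, Prop. 1.6] -/
theorem isAutAmple_fiberProduct_of_fst (X : FiberProduct F G) (h : IsAutAmple F X.fst) :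
    IsAutAmple (fiberProductFunctor F G) X := by
  intro j'
  let j₀ : X.snd ≅ X.snd := j'
  obtain ⟨j, hj⟩ := h (X.e ≪≫ G.mapIso j₀ ≪≫ X.e.symm)
  have hjh : Base F j.hom = X.e.hom ≫ G.map j₀.hom ≫ X.e.inv := congrArg Iso.hom hj
  have hw : Base F j.hom ≫ X.e.hom = X.e.hom ≫ G.map j₀.hom := by
    rw [hjh, Category.assoc, Category.assoc, Iso.inv_hom_id, Category.comp_id]
  exact ⟨CFP.isoMk j j₀ hw, Iso.ext rfl⟩

end PreFrobenioid

end Literature.AlgebraicGeometry.Frobenioids
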